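import Summits.ValiantsHypothesis.ValiantsHypothesis.Theorems.EquivariantDialLayersApolarSurvivors
import Summits.ValiantsHypothesis.ValiantsHypothesis.Theorems.EquivariantDialLayersNonempty
import HarnessLib

/-!
# The leaf `R^lay`: the window-equivariant ideal width of `per_m` is superpolynomial (`IdealWidthSuperpoly biPermSubst`)

File R5 (last) of the «block-witness apolar bound» programme (`EquivariantDialLayers*`).  HONEST SCOPE.  PROVES the typed
leaf `R^lay := EquivariantDialLayers.IdealWidthSuperpoly biPermSubst` (`∀ c, ∃ m d, d ≤ m ∧ m ^ c + c <
idealWidth (biPermSubst m) per_m d`, on the explicit schedule `d = (c+2)²`, `m = (d+1)²`) and, by the landed kernel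
`eqHardLayered_of_idealWidthSuperpoly` (`R^lay ⟹ A^lay`), the layered census cell `A^lay := EqHardLayeredBiPerm` — an
UNCONDITIONAL kernel theorem «no polynomial-width family of `𝔖_m × 𝔖_m`-equivariant homogeneous layered branching
programs with exact layerwise lifts computes `per_m`».  Does NOT prove the cell `A = EqHardBiPerm`
(stmt-ValiantsHypothesis-23702: the converse `A^lay ⟹ A` is OPEN — in the tree only conditional on `CoLeviLifts` and
von zur Gathen's rank fact, `…EquivariantDialBlockGaugeAssembly`, not imported, not claimed), nor
`DcPerSuperpolynomial ℂ`, nor `VP ≠ VNP`; closes NO ledger item (lane `--supports`).  Mechanism KNOWN (isotypic dimension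
counting for `𝔖_m × 𝔖_m`, Serre §2.6 Thm 8; hook-length / first-row peeling floor `C(m, m-λ₁) ≤ e·f^λ`); INSIDE the
catalogued equivariance barrier (an equivariant lower bound — Landsberg–Ressayre 2017, Dawar–Wilsenach 2020), 0
S-currency, necessity side of S only.  MODEL NON-VACUITY (critic K6): the model class of `A^lay`
(`HasLayeredWidthLE (biPermSubst m) per_m m w` for some `w`) is inhabited IN KERNEL only at `m ≤ 1`
(`…BlockGaugeCost.hasLayeredWidthLE_perPoly_zero/one`) and, one application of `hasLayeredWidthLE_of_hasBlockGaugeRepr`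
away (not stated in the tree), at `m = 2` from the pad `…BlockGaugeAssembly.hasBlockGaugeRepr_perPoly_two`; at general
`m ≥ 3` it is inhabited ON PAPER (the `𝔖_m × 𝔖_m`-equivariant MINORS program: layer-`k` nodes = pairs `(R, C)` of
`k`-subsets carrying `per` of the `R × C` block, edges `(R, C) → (R+i, C+j)` weighted `x_{ij}/(k+1)`, width `max_k C(m,k)²`,
exact lifts by permuting the subsets) and in the tree only conditionally (`…LeVerrierABP` l.141 / `…BlockGaugeLift`
l.229 from block-gauge data) — NOT in kernel.  The proof below does not use vacuity: it bounds the finite, attained `idealWidth`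
(`…Nonempty.exists_hasIdealWidthLE` + `Nat.sInf_mem`) from below, so `R^lay` is quantitative content regardless.

ARGUMENT.  ★★★ (`…ApolarSurvivors.exists_type_of_hasIdealWidthLE`, `p = q = d+1`): a window-stable degree-`d` cut of
`per_m` by `r` forms has a type `λ ⊠ μ` with `f^λ f^μ ≤ r`, depths `A = m-λ₁`, `B = m-μ₁ ≤ d` and `AB ≥ d`; the width
set is non-empty (`…Nonempty.exists_hasIdealWidthLE`), so this applies to `r = idealWidth`.  Floors: `(d+1)^k ≤ C(m,k)`
for `k ≤ d` (§1) and `C(m, A) ≤ e · f^λ` (Literature `FirstRowPeeling.choose_mul_numStandardTableaux_le_exp_mul`, as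
`3A ≤ m`), so `(d+1)^{A+B} ≤ e² · r`; and `(A+B)² ≥ 4AB ≥ 4d = (2(c+2))²` gives `A + B ≥ 2(c+2)`, i.e.
`m^{c+2} ≤ (d+1)^{A+B} ≤ e²·r < 8r`, whence `m^c + c < r` (`m ≥ 25`).  References:
[cite: SerreLinearRepresentations1977, §2.6 Thm. 8]; [cite: FrameRobinsonThrallCJM1954, Theorem 1];
[cite: BurgisserEtAl2011, Prop. 4.5.4]; [cite: Nisan1991Noncommutative, Thm 1].
-/

set_option linter.dupNamespace false

namespace Summit.ValiantsHypothesis.ValiantsHypothesis.Theorems.EquivariantDialLayersSuperpoly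

open Literature.Computability.AlgebraicComplexity Literature.NumberTheory.DiophantineGeometry
open EquivariantDialNode EquivariantDialLayers EquivariantDialLayersNonempty EquivariantDialLayersApolarSurvivors

/-! ## §1 Two counting floors -/

/-- `(d+1)^k ≤ C((d+1)², k)` for `k ≤ d` (each of the first `d` factors `(m-i)/(i+1)` of `C(m,k)` is `≥ d+1`). -/
theorem pow_le_choose_sq {d k : ℕ} (hk : k ≤ d) : (d + 1) ^ k ≤ ((d + 1) * (d + 1)).choose k := by
  induction k with
  | zero => simp
  | succ k ih =>
    have h1 := ih (by omega)
    have hX : (d + 1) * (k + 1) + (d + 1) ≤ (d + 1) * (d + 1) :=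
      calc (d + 1) * (k + 1) + (d + 1) = (d + 1) * (k + 2) := by ring
        _ ≤ (d + 1) * (d + 1) := Nat.mul_le_mul_left _ (by omega)
    have hmk : (d + 1) * (k + 1) ≤ (d + 1) * (d + 1) - k := by omega
    have key : (d + 1) ^ (k + 1) * (k + 1) ≤ ((d + 1) * (d + 1)).choose (k + 1) * (k + 1) := by
      rw [Nat.choose_succ_right_eq, pow_succ, mul_assoc]
      exact Nat.mul_le_mul h1 hmk
    exact Nat.le_of_mul_le_mul_right key (Nat.succ_pos k)

/-- `C(n, n - λ₁) ≤ e · f^λ` when `3 (n - λ₁) ≤ n`: the first-row peeling floor of the hook length formula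
(Literature `FirstRowPeeling`), with `f^ν ≥ 1` for the peeled shape `ν`. [cite: FrameRobinsonThrallCJM1954, Theorem 1] -/
theorem choose_le_exp_mul_numStandardTableaux {n : ℕ} (la : Nat.Partition n) (hn : n ≠ 0)
    (h3 : 3 * (n - la.sortedParts.getD 0 0) ≤ n) :
    ((n.choose (n - la.sortedParts.getD 0 0) : ℕ) : ℝ) ≤ Real.exp 1 * numStandardTableaux la := by
  obtain ⟨ν, hs⟩ := exists_sortedParts_eq_sup_cons la hn
  have hsum := add_eq_of_sortedParts_eq_cons hs
  have hget : la.sortedParts.getD 0 0 = la.parts.sup := by simp [hs]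
  have key := choose_mul_numStandardTableaux_le_exp_mul hs (by omega)
  have hν : (1 : ℝ) ≤ numStandardTableaux ν :=
    Nat.one_le_cast.2 (Nat.succ_le_of_lt (numStandardTableaux_pos_holds ν))
  rw [hget]
  calc ((n.choose (n - la.parts.sup) : ℕ) : ℝ)
      ≤ (n.choose (n - la.parts.sup) : ℝ) * numStandardTableaux ν :=
        le_mul_of_one_le_right (Nat.cast_nonneg _) hν
    _ ≤ Real.exp 1 * numStandardTableaux la := key

/-! ## §2 Depths of a window-stable cut of `per_{(d+1)²}` and the floor `(d+1)^{A+B} ≤ e²·r` -/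

/-- For `d ≥ 2`, `m = (d+1)²`: a window-stable degree-`d` cut of `per_m` by `r` forms has depths `A, B ≤ d` with
`AB ≥ d` and `(d+1)^{A+B} ≤ e² · r` (★★★ + the two floors). [cite: SerreLinearRepresentations1977, §2.6 Thm. 8] -/
theorem exists_depths_of_hasIdealWidthLE {d r : ℕ} (hd : 2 ≤ d)
    (h : HasIdealWidthLE (biPermSubst ((d + 1) * (d + 1))) (perPoly (Fin ((d + 1) * (d + 1))) ℂ) d r) :
    ∃ A B : ℕ, A ≤ d ∧ B ≤ d ∧ d ≤ A * B ∧
      (((d + 1) ^ (A + B) : ℕ) : ℝ) ≤ Real.exp 1 * Real.exp 1 * r := by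
  obtain ⟨la, mu, hr, hla, hmu, hprod⟩ :=
    exists_type_of_hasIdealWidthLE (p := d + 1) (q := d + 1) (by omega) (by omega) (by omega) (by omega) h
  have h3 : 3 * d ≤ (d + 1) * (d + 1) := by nlinarith [Nat.mul_le_mul_right d hd]
  have hla' := choose_le_exp_mul_numStandardTableaux la (by omega) (by omega)
  have hmu' := choose_le_exp_mul_numStandardTableaux mu (by omega) (by omega)
  have hA := pow_le_choose_sq (d := d) (k := (d + 1) * (d + 1) - la.sortedParts.getD 0 0) (by omega)
  have hB := pow_le_choose_sq (d := d) (k := (d + 1) * (d + 1) - mu.sortedParts.getD 0 0) (by omega)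
  have hr' : ((numStandardTableaux la : ℕ) : ℝ) * ((numStandardTableaux mu : ℕ) : ℝ) ≤ r := by
    exact_mod_cast hr
  generalize numStandardTableaux la = Fa at hla' hr'
  generalize numStandardTableaux mu = Fb at hmu' hr'
  generalize hAd : (d + 1) * (d + 1) - la.sortedParts.getD 0 0 = A at hla' hA hprod
  generalize hBd : (d + 1) * (d + 1) - mu.sortedParts.getD 0 0 = B at hmu' hB hprod
  generalize (d + 1) * (d + 1) = m at hla' hmu' hA hB
  refine ⟨A, B, by omega, by omega, hprod, ?_⟩
  have hN : (d + 1) ^ (A + B) ≤ m.choose A * m.choose B := by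
    rw [pow_add]; exact Nat.mul_le_mul hA hB
  calc (((d + 1) ^ (A + B) : ℕ) : ℝ) ≤ ((m.choose A * m.choose B : ℕ) : ℝ) := by exact_mod_cast hN
    _ = (m.choose A : ℝ) * (m.choose B : ℝ) := Nat.cast_mul _ _
    _ ≤ (Real.exp 1 * Fa) * (Real.exp 1 * Fb) := mul_le_mul hla' hmu' (Nat.cast_nonneg _) (by positivity)
    _ = Real.exp 1 * Real.exp 1 * ((Fa : ℝ) * Fb) := by ring
    _ ≤ Real.exp 1 * Real.exp 1 * r := mul_le_mul_of_nonneg_left hr' (by positivity)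

/-! ## §3 The schedule `d = (c+2)²`, `m = (d+1)²` and the leaf -/

/-- THE COUNT at `m = (d+1)²`, `4d = (2(c+2))²`, `d ≥ 4`: `m ^ c + c < idealWidth (biPermSubst m) per_m d`
(`m^{c+2} = (d+1)^{2(c+2)} ≤ (d+1)^{A+B} ≤ e²·width < 8·width` and `m² ≥ 625`). -/
theorem pow_add_lt_idealWidth_of {c d : ℕ} (hd4 : 4 ≤ d) (hdc : 2 * (c + 2) * (2 * (c + 2)) = 4 * d) :
    ((d + 1) * (d + 1)) ^ c + c <
      idealWidth (biPermSubst ((d + 1) * (d + 1))) (perPoly (Fin ((d + 1) * (d + 1))) ℂ) d := by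
  have hdm : d ≤ (d + 1) * (d + 1) := (Nat.le_succ d).trans (Nat.le_mul_self (d + 1))
  have h25 : 25 ≤ (d + 1) * (d + 1) := by nlinarith [Nat.mul_le_mul hd4 hd4]
  have hw : HasIdealWidthLE (biPermSubst ((d + 1) * (d + 1))) (perPoly (Fin ((d + 1) * (d + 1))) ℂ) d
      (idealWidth (biPermSubst ((d + 1) * (d + 1))) (perPoly (Fin ((d + 1) * (d + 1))) ℂ) d) := by
    unfold idealWidth; exact Nat.sInf_mem (exists_hasIdealWidthLE hdm)
  obtain ⟨A, B, -, -, hAB, hR⟩ := exists_depths_of_hasIdealWidthLE (d := d) (by omega) hw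
  have hsum : 2 * (c + 2) ≤ A + B := by
    have h4 : 4 * (A * B) ≤ (A + B) * (A + B) := by
      zify; nlinarith [sq_nonneg ((A : ℤ) - (B : ℤ))]
    have h5 : 2 * (c + 2) * (2 * (c + 2)) ≤ (A + B) * (A + B) := by
      rw [hdc]; exact (Nat.mul_le_mul_left 4 hAB).trans h4
    exact Nat.mul_self_le_mul_self_iff.1 h5
  have hpow : ((d + 1) * (d + 1)) ^ (c + 2) ≤ (d + 1) ^ (A + B) := by
    have hP : ((d + 1) * (d + 1)) ^ (c + 2) = (d + 1) ^ (2 * (c + 2)) := by rw [pow_mul, pow_two]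
    rw [hP]; exact Nat.pow_le_pow_right (Nat.succ_pos d) hsum
  have he : Real.exp 1 * Real.exp 1 ≤ 8 := by nlinarith [Real.exp_pos 1, Real.exp_one_lt_d9]
  have h8 : ((d + 1) * (d + 1)) ^ (c + 2) ≤
      8 * idealWidth (biPermSubst ((d + 1) * (d + 1))) (perPoly (Fin ((d + 1) * (d + 1))) ℂ) d := by
    have key : ((((d + 1) * (d + 1)) ^ (c + 2) : ℕ) : ℝ) ≤
        8 * (idealWidth (biPermSubst ((d + 1) * (d + 1))) (perPoly (Fin ((d + 1) * (d + 1))) ℂ) d : ℕ) :=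
      calc ((((d + 1) * (d + 1)) ^ (c + 2) : ℕ) : ℝ) ≤ (((d + 1) ^ (A + B) : ℕ) : ℝ) := by exact_mod_cast hpow
        _ ≤ _ := hR
        _ ≤ _ := mul_le_mul_of_nonneg_right he (Nat.cast_nonneg _)
    exact_mod_cast key
  have h625 : 625 * ((d + 1) * (d + 1)) ^ c ≤ ((d + 1) * (d + 1)) ^ (c + 2) :=
    calc 625 * ((d + 1) * (d + 1)) ^ c = ((d + 1) * (d + 1)) ^ c * 25 * 25 := by ring
      _ ≤ ((d + 1) * (d + 1)) ^ c * ((d + 1) * (d + 1)) * ((d + 1) * (d + 1)) :=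
          Nat.mul_le_mul (Nat.mul_le_mul_left _ h25) h25
      _ = ((d + 1) * (d + 1)) ^ (c + 2) := by rw [pow_add, pow_two, mul_assoc]
  have hX : c < ((d + 1) * (d + 1)) ^ c := Nat.lt_pow_self (by omega)
  omega

/-- EXPLICIT SCHEDULE: `m ^ c + c < idealWidth (biPermSubst m) per_m d` for `d = (c+2)²`, `m = (d+1)²`. -/
theorem pow_add_lt_idealWidth (c : ℕ) :
    (((c + 2) ^ 2 + 1) * ((c + 2) ^ 2 + 1)) ^ c + c <
      idealWidth (biPermSubst (((c + 2) ^ 2 + 1) * ((c + 2) ^ 2 + 1)))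
        (perPoly (Fin (((c + 2) ^ 2 + 1) * ((c + 2) ^ 2 + 1))) ℂ) ((c + 2) ^ 2) := by
  have hd4 : 4 ≤ (c + 2) ^ 2 := by
    rw [pow_two]; exact Nat.mul_le_mul (by omega : 2 ≤ c + 2) (by omega : 2 ≤ c + 2)
  exact pow_add_lt_idealWidth_of hd4 (by ring)

/-- ★ THE LEAF `R^lay`: the `𝔖_m × 𝔖_m`-window-equivariant ideal width of `per_m` is superpolynomial at the cuts
`d = (c+2)²`, `m = (d+1)²`.  RIDER: an EQUIVARIANT lower bound (inside the equivariance barrier); it proves neither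
`EqHardBiPerm` (cell `A`, stmt-ValiantsHypothesis-23702) nor `DcPerSuperpolynomial` nor `VP ≠ VNP`.
[cite: SerreLinearRepresentations1977, §2.6 Thm. 8] -/
theorem idealWidthSuperpoly_biPermSubst : IdealWidthSuperpoly biPermSubst := fun c =>
  ⟨_, (c + 2) ^ 2, (Nat.le_succ _).trans (Nat.le_mul_self _), pow_add_lt_idealWidth c⟩

/-- ★ Hence the layered census cell `A^lay = EqHardLayeredBiPerm` (no polynomial-width `𝔖_m × 𝔖_m`-equivariant
homogeneous layered branching programs with exact layerwise lifts for `per_m`), by the landed kernel `R^lay ⟹ A^lay`.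
RIDER: the non-layered cell `A = EqHardBiPerm` needs the open converse `A^lay ⟹ A` (tree: conditional on `CoLeviLifts`
and von zur Gathen's rank fact); `VP ≠ VNP` untouched. [cite: Nisan1991Noncommutative, Thm 1] -/
theorem eqHardLayeredBiPerm : EqHardLayeredBiPerm :=
  eqHardLayered_of_idealWidthSuperpoly idealWidthSuperpoly_biPermSubst

end Summit.ValiantsHypothesis.ValiantsHypothesis.Theorems.EquivariantDialLayersSuperpoly
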